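import Summits.ResolutionOfSingularities.ResolutionOfSingularities.Theorems.FrobeniusLadderFRationalResolutionFlatPrimeDescent
import Summits.ResolutionOfSingularities.ResolutionOfSingularities.Theorems.FrobeniusLadderFRationalResolutionFiniteFlatDimension
import Literature.AlgebraicGeometry.Resolution.NagataCriterion
import Literature.AlgebraicGeometry.Resolution.LogRegularResolution
import Mathlib.RingTheory.TensorProduct.Quotient
import Mathlib.RingTheory.IntegralClosure.IsIntegralClosure.Basic
import HarnessLib

/-!
# Crux `FrobeniusLadder.FRationalResolution` (stmt-ResolutionOfSingularities-15317), line `redirect`,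
# stub `stub_diagonalizableQuotientResolution` — **Kato's condition (2.1) DESCENDS along a flat
# integral extension when the Kato ideals match** (brick W4' of memo MEMO-15317-leafhand2-g4 §2ter)

Generic commutative algebra, no gradings. `R → T` flat and integral (both Noetherian; the case in
view is the finite free Kummer cover `S₀ → S^{(B)} = ⊕_{b ∈ B} S_b` of the quotient chart at a WILD
point, which is inseparable, so nothing étale is available), a prime `𝔮` of `T` over `𝔮₀`, charts
`ψ : P₀ → R` (`P₀ ⊆ ℤᴺ`) and `φ : P → T` (`P ⊆ ℤⁿ`) whose Kato ideals at `𝔮₀`, `𝔮` satisfy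
`I(𝔮₀)·T = I(𝔮)` and whose rank terms `N − rk F_{𝔮₀}ᵍᵖ`, `n − rk F_𝔮ᵍᵖ` agree. Then
`(T, φ)` log regular at `𝔮` ⇒ `(R, ψ)` log regular at `𝔮₀`:
(i) `R_{𝔮₀}/I(𝔮₀) → T_𝔮/I(𝔮₀)T_𝔮 = T_𝔮/I(𝔮)` is flat local (base change), so regularity descends
(Matsumura 23.7 (i), `…FlatPrimeDescent`), through `B_q/IB_q = (B/I)_{q/I}` (tree's
`isRegularLocalRing_localization_quotient_iff`);
(ii) `dim T_𝔮 = dim R_{𝔮₀}` and `dim T_𝔮/I(𝔮) = dim R_{𝔮₀}/I(𝔮₀)` (flat + integral: going-down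
dimension formula and incomparability, `…FiniteFlatDimension`, applied to `R → T` and to
`R/I(𝔮₀) → T/I(𝔮₀)T`).

* `liesOver_map_quotientMk` — `𝔮/JT` lies over `𝔮₀/J` for `J ≤ 𝔮₀`; `flat_quotient_map`,
  `isIntegral_quotient_map` — `T/JT` is flat, resp. integral, over `R/J`;
* `ringKrullDim_localization_quotient_eq` — `dim T_𝔮/JT_𝔮 = dim R_{𝔮₀}/JR_{𝔮₀}`;
* `isRegularLocalRing_localization_quotient_of_flat` — `T_𝔮/JT_𝔮` regular ⇒ `R_{𝔮₀}/JR_{𝔮₀}` regular;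
* **`isLogRegularAt_of_flat_of_isIntegral`** — the descent of `LogChart.IsLogRegularAt`.

Honest label: generic brick of the wild non-fixed route (no stub closed). No definitions, no named
facts, no sorry. [cite: Kato1994, Def. (2.1)] [cite: Matsumura1987, Thm. 23.7 (i), Thm. 15.1]
-/

noncomputable section

-- single-problem summit: the doubled namespace component is forced
set_option linter.dupNamespace false

open Literature.AlgebraicGeometry.Resolution

namespace Summit.ResolutionOfSingularities.ResolutionOfSingularities.Theorems.FRationalResolution.LogRegularDescent

universe u

variable {R T : Type u} [CommRing R] [CommRing T] [Algebra R T]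

/-- For `J ≤ 𝔮₀` and `𝔮` over `𝔮₀`, the prime `𝔮/JT` of `T/JT` lies over the prime `𝔮₀/J` of
`R/J`. [folklore] -/
theorem liesOver_map_quotientMk (J 𝔮₀ : Ideal R) (𝔮 : Ideal T) [𝔮.LiesOver 𝔮₀] (hJ : J ≤ 𝔮₀) :
    (𝔮.map (Ideal.Quotient.mk (J.map (algebraMap R T)))).LiesOver
      (𝔮₀.map (Ideal.Quotient.mk J)) := by
  have hJT : J.map (algebraMap R T) ≤ 𝔮 := by
    rw [Ideal.map_le_iff_le_comap]
    exact fun r hr => Ideal.mem_comap.mpr ((Ideal.mem_of_liesOver 𝔮 𝔮₀ r).mp (hJ hr))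
  refine ⟨le_antisymm ?_ ?_⟩
  · rw [Ideal.map_le_iff_le_comap]
    intro r hr
    rw [Ideal.mem_comap, Ideal.mem_comap, Ideal.Quotient.algebraMap_quotient_map_quotient]
    exact Ideal.mem_map_of_mem _ ((Ideal.mem_of_liesOver 𝔮 𝔮₀ r).mp hr)
  · intro x hx
    obtain ⟨r, rfl⟩ := Ideal.Quotient.mk_surjective x
    rw [Ideal.mem_comap, Ideal.Quotient.algebraMap_quotient_map_quotient,
      Ideal.mem_quotient_iff_mem hJT] at hx
    exact Ideal.mem_map_of_mem _ ((Ideal.mem_of_liesOver 𝔮 𝔮₀ r).mpr hx)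

/-- `T/JT` is flat over `R/J` when `T` is flat over `R` (base change). [folklore] -/
theorem flat_quotient_map (J : Ideal R) [Module.Flat R T] :
    Module.Flat (R ⧸ J) (T ⧸ J.map (algebraMap R T)) :=
  Module.Flat.of_linearEquiv (Algebra.TensorProduct.quotIdealMapEquivQuotTensor T J).toLinearEquiv

/-- `T/JT` is integral over `R/J` when `T` is integral over `R`. [folklore] -/
theorem isIntegral_quotient_map (J : Ideal R) [Algebra.IsIntegral R T] :
    Algebra.IsIntegral (R ⧸ J) (T ⧸ J.map (algebraMap R T)) :=
  Algebra.IsIntegral.tower_top R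

/-- **Quotient local dimensions agree along a flat integral extension**: for `R → T` flat and
integral (Noetherian), `J ≤ 𝔮₀`, `𝔮` over `𝔮₀`: `dim T_𝔮/JT_𝔮 = dim R_{𝔮₀}/JR_{𝔮₀}`.
[cite: Matsumura1987, Thm. 15.1] -/
theorem ringKrullDim_localization_quotient_eq [IsNoetherianRing R] [IsNoetherianRing T]
    [Module.Flat R T] [Algebra.IsIntegral R T] (J 𝔮₀ : Ideal R) [𝔮₀.IsPrime] (𝔮 : Ideal T)
    [𝔮.IsPrime] [𝔮.LiesOver 𝔮₀] (hJ : J ≤ 𝔮₀) :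
    ringKrullDim (Localization.AtPrime 𝔮 ⧸
        (J.map (algebraMap R T)).map (algebraMap T (Localization.AtPrime 𝔮))) =
      ringKrullDim (Localization.AtPrime 𝔮₀ ⧸ J.map (algebraMap R (Localization.AtPrime 𝔮₀))) := by
  have hJT : J.map (algebraMap R T) ≤ 𝔮 := by
    rw [Ideal.map_le_iff_le_comap]
    exact fun r hr => Ideal.mem_comap.mpr ((Ideal.mem_of_liesOver 𝔮 𝔮₀ r).mp (hJ hr))
  haveI : (𝔮₀.map (Ideal.Quotient.mk J)).IsPrime := Ideal.isPrime_map_quotientMk_of_isPrime hJ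
  haveI : (𝔮.map (Ideal.Quotient.mk (J.map (algebraMap R T)))).IsPrime :=
    Ideal.isPrime_map_quotientMk_of_isPrime hJT
  haveI := liesOver_map_quotientMk J 𝔮₀ 𝔮 hJ
  haveI := flat_quotient_map (R := R) (T := T) J
  haveI := isIntegral_quotient_map (R := R) (T := T) J
  haveI := isLocalization_atPrime_localization_quotient J 𝔮₀ hJ
  haveI := isLocalization_atPrime_localization_quotient (J.map (algebraMap R T)) 𝔮 hJT
  exact FiniteFlatDimension.ringKrullDim_atPrime_eq_of_flat_of_isIntegral
    (R := R ⧸ J) (S := T ⧸ J.map (algebraMap R T))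
    (𝔮₀.map (Ideal.Quotient.mk J)) (𝔮.map (Ideal.Quotient.mk (J.map (algebraMap R T))))
    (Localization.AtPrime 𝔮₀ ⧸ J.map (algebraMap R (Localization.AtPrime 𝔮₀)))
    (Localization.AtPrime 𝔮 ⧸ (J.map (algebraMap R T)).map (algebraMap T (Localization.AtPrime 𝔮)))

/-- **Regularity of the quotient local rings descends along a flat extension**: for `R → T` flat
(`R` Noetherian), `J ≤ 𝔮₀`, `𝔮` over `𝔮₀`: `T_𝔮/JT_𝔮` regular ⇒ `R_{𝔮₀}/JR_{𝔮₀}` regular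
(`R_{𝔮₀}/J → T_𝔮/JT_𝔮` is flat local). [cite: Matsumura1987, Thm. 23.7 (i)] -/
theorem isRegularLocalRing_localization_quotient_of_flat [IsNoetherianRing R] [Module.Flat R T]
    (J 𝔮₀ : Ideal R) [𝔮₀.IsPrime] (𝔮 : Ideal T) [𝔮.IsPrime] [𝔮.LiesOver 𝔮₀] (hJ : J ≤ 𝔮₀)
    (h : IsRegularLocalRing (Localization.AtPrime 𝔮 ⧸
      (J.map (algebraMap R T)).map (algebraMap T (Localization.AtPrime 𝔮)))) :
    IsRegularLocalRing (Localization.AtPrime 𝔮₀ ⧸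
      J.map (algebraMap R (Localization.AtPrime 𝔮₀))) := by
  have hJT : J.map (algebraMap R T) ≤ 𝔮 := by
    rw [Ideal.map_le_iff_le_comap]
    exact fun r hr => Ideal.mem_comap.mpr ((Ideal.mem_of_liesOver 𝔮 𝔮₀ r).mp (hJ hr))
  haveI : (𝔮₀.map (Ideal.Quotient.mk J)).IsPrime := Ideal.isPrime_map_quotientMk_of_isPrime hJ
  haveI : (𝔮.map (Ideal.Quotient.mk (J.map (algebraMap R T)))).IsPrime :=
    Ideal.isPrime_map_quotientMk_of_isPrime hJT
  haveI hover := liesOver_map_quotientMk J 𝔮₀ 𝔮 hJ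
  haveI := flat_quotient_map (R := R) (T := T) J
  rw [isRegularLocalRing_localization_quotient_iff _ 𝔮 hJT] at h
  rw [isRegularLocalRing_localization_quotient_iff J 𝔮₀ hJ]
  haveI := h
  exact FlatPrimeDescent.isRegularLocalRing_atPrime_of_flat
    (B := R ⧸ J) (B' := T ⧸ J.map (algebraMap R T))
    (𝔮.map (Ideal.Quotient.mk (J.map (algebraMap R T)))) (𝔮₀.map (Ideal.Quotient.mk J))
    hover.over

/-- **Kato's (2.1) descends along a flat integral extension with matching Kato ideals.** `R → T`
flat and integral, both Noetherian; `𝔮` over `𝔮₀`; charts `ψ : P₀ → R` (`P₀ ⊆ ℤᴺ`),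
`φ : P → T` (`P ⊆ ℤⁿ`) with `I_ψ(𝔮₀)·T = I_φ(𝔮)` and `N − rk F_ψ(𝔮₀)ᵍᵖ = n − rk F_φ(𝔮)ᵍᵖ`. If
`(T, φ)` is log regular at `𝔮` then `(R, ψ)` is log regular at `𝔮₀`.
[cite: Kato1994, Def. (2.1)] [cite: Matsumura1987, Thm. 23.7 (i), Thm. 15.1] -/
theorem isLogRegularAt_of_flat_of_isIntegral [IsNoetherianRing R] [IsNoetherianRing T]
    [Module.Flat R T] [Algebra.IsIntegral R T] {N n : ℕ} (P₀ : AddSubmonoid (Fin N → ℤ))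
    (ψ : Multiplicative P₀ →* R) (P : AddSubmonoid (Fin n → ℤ)) (φ : Multiplicative P →* T)
    (𝔮₀ : Ideal R) [𝔮₀.IsPrime] (𝔮 : Ideal T) [𝔮.IsPrime] [𝔮.LiesOver 𝔮₀]
    (hI : (LogChart.ideal P₀ ψ 𝔮₀).map (algebraMap R T) = LogChart.ideal P φ 𝔮)
    (hrank : N - Module.finrank ℤ
        (Submodule.span ℤ ((fun p : P₀ => (p : Fin N → ℤ)) '' LogChart.face P₀ ψ 𝔮₀)) =
      n - Module.finrank ℤ
        (Submodule.span ℤ ((fun p : P => (p : Fin n → ℤ)) '' LogChart.face P φ 𝔮)))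
    (h : LogChart.IsLogRegularAt P φ 𝔮) : LogChart.IsLogRegularAt P₀ ψ 𝔮₀ := by
  have hJ : LogChart.ideal P₀ ψ 𝔮₀ ≤ 𝔮₀ := LogChart.ideal_le P₀ ψ 𝔮₀
  obtain ⟨hreg, hdim⟩ := h
  rw [← hI] at hreg hdim
  refine ⟨isRegularLocalRing_localization_quotient_of_flat _ 𝔮₀ 𝔮 hJ hreg, ?_⟩
  rw [← FiniteFlatDimension.ringKrullDim_atPrime_eq_of_flat_of_isIntegral 𝔮₀ 𝔮
      (Localization.AtPrime 𝔮₀) (Localization.AtPrime 𝔮),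
    ← ringKrullDim_localization_quotient_eq _ 𝔮₀ 𝔮 hJ, hrank]
  exact hdim

end Summit.ResolutionOfSingularities.ResolutionOfSingularities.Theorems.FRationalResolution.LogRegularDescent

end
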